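import Mathlib
import Summits.NavierStokesRegularity.NavierStokesRegularity.Theorems.SubOnsagerCeilingKPSecondaryBarrier
import Summits.NavierStokesRegularity.NavierStokesRegularity.Theorems.OrthantWakeOrthantBreakOfWake
import HarnessLib

/-!
# Secondary sources of a KP network proper, II: the assembly and the CONDITIONAL `FwdCeilingKPAt`
(helper file for crux stmt-NavierStokesRegularity-27057 `SubOnsagerCeiling.ForwardTailCeilingKP`,
`--supports … --as helper`; LEAD SE seat ns-senv-p1 as KEY-NS #146 (1) / #147 (3) hands for LEAD SOC)

LEAD SOC's census v6 §C decomposes STUB 1 of the crux into S-sec (secondary sources are slaved to their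
neighbours — pair slaving), S-sink (pure sinks only drain), S-prim (ν-uniform envelope of the PRIMARY
forward-fed sub-network = the crux proper) and an assembly. This file is the assembly with S-prim left as
an explicit HYPOTHESIS:
* `kpProper_sources_envelope_of_primary` — per solution: for a set `P` of components such that every
  forward source outside `P` has (F) its feeders, (Q) its in-shell partners and (T) for one of its
  targets the target's feed targets and pump partners inside `P`, an envelope `|X_{i,k}| ≤ M(1+ε₀)^{-θk}`
  of the `P`-modes (`0 ≤ θ ≤ 1`) plus `|X_{j,0}| ≤ M` for all `j` gives `|X_{a,k}| ≤ 20R·M(1+ε₀)^{-θk}`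
  for EVERY forward source `a`, uniformly in `ν` (`kpProper_secondary_barrier`, companion file I);
* `sources_tail_le` — the geometric tail sum over a set of sources;
* `fwdCeilingKP_of_primaryEnvelope` — CLASS LEVEL: the structural clauses for `(α, P)` and a ν-uniform
  `θ`-barrier (`1/2 < θ ≤ 1`) of the `P`-modes along every honest viscous solution imply the body of the
  crux's per-table statement `FwdCeilingKPAt R ε₀ α` (skeleton `Cruxes/ForwardTailCeilingKP/Lines/
  kp_shell_barrier.lean`) VERBATIM, with `S = S⁺(α)`, the same `θ`, `C = 1600R² max(D,1)/(1 − (1+ε₀)^{-2θ})`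
  (shell `0` is controlled by the energy bound `orthantBreak_energy_le`).
So on KP networks proper whose non-primary sources are one step from primary (fed by primary squares,
in-shell partners primary, draining into a sink or into a primary with primary partners), the
forward-source tail ceiling is REDUCED to the primary envelope — «dead ends are not forward sources» as
a kernel implication. NOT here: the primary envelope itself (S-prim); multi-step secondary chains (each
step costs the factor `20R`); sources whose target drains into non-primary modes (re-entry).

HONEST FRAMING: statements about Tao-type MODEL lattice tables (rung TL-M2Break, route SubOnsagerCeiling);
a conditional reduction, not a proof of the crux; nothing here bears on Navier–Stokes regularity.
-/

noncomputable section

-- the sub-problem namespace `NavierStokesRegularity.NavierStokesRegularity` is the tree's layout (D-0017)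
set_option linter.dupNamespace false

namespace Summit.NavierStokesRegularity.NavierStokesRegularity.Theorems

open Set Finset Filter Topology
open Literature.Analysis.FluidPDE.TaoCascade

/-! ## §1 Per-solution assembly: every source is enveloped once the primary modes are -/

/-- **ASSEMBLY (per solution).** KP network proper `α ∈ E₂(R)`, `0 < ε₀ ≤ 1`, an honest `ν`-viscous
solution on `[0,s]` (zero datum on shells `≥ 1`, non-negative on shells `≥ 1`, all modes bounded by `W`),
a set `P` of components and an envelope `|X_{i,k}(t)| ≤ M(1+ε₀)^{-θk}` (`i ∈ P`, `k ≥ 0`, `0 ≤ θ ≤ 1`,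
`M > 0`) together with `|X_{j,0}(t)| ≤ M` for every `j`. STRUCTURE: every forward source `a ∉ P`
satisfies (F) its feeders are in `P` (`w_{ja} ≠ 0 ⇒ j ∈ P`), (Q) its in-shell partners are in `P`
(`α i₁ i₂ a (0,0,0) ≠ 0`, `i₁, i₂ ≠ a ⇒ i₁, i₂ ∈ P`), (T) for SOME target `e` of `a`, the feed targets
of `e` and the in-shell pump partners of `e` are in `P`. THEN every forward source `a` (in `P` or not)
obeys `|X_{a,k}(t)| ≤ 20R·M(1+ε₀)^{-θk}` for all `k ≥ 0`, `t ∈ [0,s]` — for every `ν ≥ 0`.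
MODEL lattice statement. [this file] -/
theorem kpProper_sources_envelope_of_primary {ε₀ ν s R M θ W : ℝ}
    {α : Fin 4 → Fin 4 → Fin 4 → ℤ × ℤ × ℤ → ℝ} {X : Fin 4 → ℤ → ℝ → ℝ}
    (hα : InTableClass R α)
    (hO : ∀ (Y : Fin 4 → ℤ → ℝ → ℝ) (τ : ℝ), (∀ (j : Fin 4) (k : ℤ), 1 ≤ k → 0 ≤ Y j k τ) →
      ∀ δ : ℝ, 0 < δ → ∀ (i : Fin 4) (n : ℤ), 1 ≤ n → Y i n τ = 0 → 0 ≤ quadTerm δ α Y i n τ)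
    (hD : ∀ a b i : Fin 4, a ≠ b → α a b i (0, 0, 1) = 0)
    (hR : 1 ≤ R) (hε : 0 < ε₀) (hε1 : ε₀ ≤ 1) (hν : 0 ≤ ν) (hθ0 : 0 ≤ θ) (hθ1 : θ ≤ 1) (hM : 0 < M)
    (hder : ∀ (i : Fin 4) (k : ℤ), ∀ t ∈ Icc (0 : ℝ) s, HasDerivWithinAt (X i k)
      (quadTerm ε₀ α X i k t - ν * (1 + ε₀) ^ ((2 : ℝ) * k) * X i k t) (Icc (0 : ℝ) s) t)
    (hdat : ∀ (i : Fin 4) (k : ℤ), 1 ≤ k → X i k 0 = 0)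
    (hnn : ∀ t ∈ Icc (0 : ℝ) s, ∀ (i : Fin 4) (k : ℤ), 1 ≤ k → 0 ≤ X i k t)
    (hWbd : ∀ t ∈ Icc (0 : ℝ) s, ∀ (j : Fin 4) (k : ℤ), |X j k t| ≤ W)
    (P : Finset (Fin 4))
    (hP : ∀ t ∈ Icc (0 : ℝ) s, ∀ i ∈ P, ∀ k : ℕ, |X i (k : ℤ) t| ≤ M * (1 + ε₀) ^ (-(θ * (k : ℝ))))
    (h0 : ∀ t ∈ Icc (0 : ℝ) s, ∀ j, |X j 0 t| ≤ M)
    (hstruct : ∀ a, a ∉ P → (∃ e, α a a e (0, 0, 1) ≠ 0) →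
      (∀ j, α j j a (0, 0, 1) ≠ 0 → j ∈ P) ∧
      (∀ i₁ i₂, i₁ ≠ a → i₂ ≠ a → α i₁ i₂ a (0, 0, 0) ≠ 0 → i₁ ∈ P ∧ i₂ ∈ P) ∧
      (∃ e, α a a e (0, 0, 1) ≠ 0 ∧ (∀ j, α e e j (0, 0, 1) ≠ 0 → j ∈ P) ∧
        (∀ j, j ≠ e → α e e j (0, 0, 0) ≠ 0 → j ∈ P))) :
    ∀ t ∈ Icc (0 : ℝ) s, ∀ a, (∃ e, α a a e (0, 0, 1) ≠ 0) →
      ∀ k : ℕ, |X a (k : ℤ) t| ≤ 20 * R * M * (1 + ε₀) ^ (-(θ * (k : ℝ))) := by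
  have hb : (0 : ℝ) < 1 + ε₀ := by linarith
  have hb1 : (1 : ℝ) ≤ 1 + ε₀ := by linarith
  have hR20 : (1 : ℝ) ≤ 20 * R := by linarith
  intro t ht a hsrc k
  have hpowpos : 0 < (1 + ε₀) ^ (-(θ * (k : ℝ))) := Real.rpow_pos_of_pos hb _
  by_cases haP : a ∈ P
  · -- primary sources: the hypothesis, weakened by the factor `20 R ≥ 1`
    have h := hP t ht a haP k
    have : M * (1 + ε₀) ^ (-(θ * (k : ℝ))) ≤ 20 * R * M * (1 + ε₀) ^ (-(θ * (k : ℝ))) := by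
      have h2 : 0 ≤ M * (1 + ε₀) ^ (-(θ * (k : ℝ))) := by positivity
      nlinarith
    exact h.trans this
  obtain ⟨hF, hQ, e, hwe, hTf, hTp⟩ := hstruct a haP hsrc
  rcases Nat.eq_zero_or_pos k with hk0 | hkpos
  · -- shell 0: the energy-type bound `|X_{a,0}| ≤ M`
    subst hk0
    have h := h0 t ht a
    have : M ≤ 20 * R * M * (1 + ε₀) ^ (-(θ * ((0 : ℕ) : ℝ))) := by
      simp only [Nat.cast_zero, mul_zero, neg_zero, Real.rpow_zero, mul_one]
      nlinarith
    simpa using h.trans this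
  -- shells k ≥ 1: the secondary barrier at scale `A = M (1+ε₀)^{-θk}`
  set A : ℝ := M * (1 + ε₀) ^ (-(θ * (k : ℝ))) with hA
  have hApos : 0 < A := by positivity
  have hk1 : (1 : ℤ) ≤ (k : ℤ) := by exact_mod_cast hkpos
  -- exponent bookkeeping
  have hup : ∀ m : ℕ, k ≤ m → M * (1 + ε₀) ^ (-(θ * (m : ℝ))) ≤ A := by
    intro m hm
    have : (1 + ε₀) ^ (-(θ * (m : ℝ))) ≤ (1 + ε₀) ^ (-(θ * (k : ℝ))) := by
      apply Real.rpow_le_rpow_of_exponent_le hb1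
      have : (k : ℝ) ≤ m := by exact_mod_cast hm
      nlinarith
    exact mul_le_mul_of_nonneg_left this hM.le
  have hdown : M * (1 + ε₀) ^ (-(θ * (((k - 1 : ℕ)) : ℝ))) ≤ 2 * A := by
    have hcast : (((k - 1 : ℕ)) : ℝ) = (k : ℝ) - 1 := by
      rw [Nat.cast_sub (by omega)]; simp
    rw [hcast]
    have hsplit : (1 + ε₀) ^ (-(θ * ((k : ℝ) - 1))) = (1 + ε₀) ^ (-(θ * (k : ℝ))) * (1 + ε₀) ^ θ := by
      rw [← Real.rpow_add hb]; congr 1; ring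
    have hθle : (1 + ε₀) ^ θ ≤ 2 := by
      have h1 : (1 + ε₀) ^ θ ≤ (1 + ε₀) ^ (1 : ℝ) := Real.rpow_le_rpow_of_exponent_le hb1 hθ1
      rw [Real.rpow_one] at h1; linarith
    rw [hsplit]
    have : M * ((1 + ε₀) ^ (-(θ * (k : ℝ))) * (1 + ε₀) ^ θ) = A * (1 + ε₀) ^ θ := by simp only [hA]; ring
    rw [this]
    nlinarith [Real.rpow_pos_of_pos hb θ]
  -- integer/natural index identities
  have ek1 : ((k : ℤ) - 1) = (((k - 1 : ℕ)) : ℤ) := by omega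
  have ek2 : ((k : ℤ) + 1) = (((k + 1 : ℕ)) : ℤ) := by push_cast; ring
  have ek3 : ((k : ℤ) + 2) = (((k + 2 : ℕ)) : ℤ) := by push_cast; ring
  have hres := kpProper_secondary_barrier (T := s) (W := W) hα hO hD hR hε hε1 hν a e (k : ℤ) hwe hApos
    (hder a k) (hder e ((k : ℤ) + 1)) hWbd
    (by -- feeders (F)
      intro u hu j hj
      have hjP := hF j hj
      have h := hP u hu j hjP (k - 1)
      rw [ek1]
      exact h.trans hdown)
    (fun u hu j => hnn u hu j k hk1)
    (by -- face partners (Q)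
      intro u hu i₁ i₂ h1 h2 h12
      obtain ⟨hi1, hi2⟩ := hQ i₁ i₂ h1 h2 h12
      exact ⟨(le_abs_self _).trans ((hP u hu i₁ hi1 k).trans (hup k le_rfl)),
        (le_abs_self _).trans ((hP u hu i₂ hi2 k).trans (hup k le_rfl))⟩)
    (fun u hu j => hnn u hu j ((k : ℤ) + 1) (by omega))
    (by -- pump partners of the target (T)
      intro u hu j hje hpj
      have hjP := hTp j hje hpj
      have h := hP u hu j hjP (k + 1)
      rw [ek2]
      exact (le_abs_self _).trans (h.trans (hup (k + 1) (by omega))))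
    (fun u hu j => hnn u hu j ((k : ℤ) + 2) (by omega))
    (by -- feed targets of the target (T)
      intro u hu j hj
      have hjP := hTf j hj
      have h := hP u hu j hjP (k + 2)
      rw [ek3]
      exact (le_abs_self _).trans (h.trans (hup (k + 2) (by omega))))
    (by rw [hdat a k hk1]; positivity)
    t ht
  have hXnn : 0 ≤ X a k t := hnn t ht a k hk1
  rw [abs_of_nonneg hXnn]
  have : 20 * R * A = 20 * R * M * (1 + ε₀) ^ (-(θ * (k : ℝ))) := by simp only [hA]; ring
  linarith

/-! ## §2 The tail sum and the class-level conditional -/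

/-- **Geometric tail sum over a set of sources.** If `|X_{a,k}(t)| ≤ M'(1+ε₀)^{-θk}` for `a ∈ S`,
`k ≥ 0` (`θ > 0`), then `Σ_{k=n}^{N} Σ_{i∈S} ½X_{i,k}(t)² ≤ (2M'²/(1 − (1+ε₀)^{-2θ}))·(1+ε₀)^{-2θn}`.
[geometric series; this file] -/
theorem sources_tail_le {ε₀ θ M' t : ℝ} {X : Fin 4 → ℤ → ℝ → ℝ} {S : Finset (Fin 4)}
    (hε : 0 < ε₀) (hθ : 0 < θ) (hM' : 0 ≤ M')
    (h : ∀ a ∈ S, ∀ k : ℕ, |X a (k : ℤ) t| ≤ M' * (1 + ε₀) ^ (-(θ * (k : ℝ)))) :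
    ∀ n N : ℕ, n ≤ N → ∑ k ∈ Finset.Icc n N, ∑ i ∈ S, (1 / 2 : ℝ) * X i (k : ℤ) t ^ 2 ≤
      2 * M' ^ 2 / (1 - (1 + ε₀) ^ (-(2 * θ))) * (1 + ε₀) ^ (-(2 * θ * (n : ℝ))) := by
  intro n N hnN
  have hb : (1 : ℝ) < 1 + ε₀ := by linarith
  have hb0 : (0 : ℝ) ≤ 1 + ε₀ := by linarith
  set r : ℝ := (1 + ε₀) ^ (-(2 * θ)) with hr_def
  have hr0 : 0 < r := Real.rpow_pos_of_pos (by linarith) _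
  have hr1 : r < 1 := by
    have : (1 + ε₀) ^ (-(2 * θ)) < (1 + ε₀) ^ (0 : ℝ) :=
      Real.rpow_lt_rpow_of_exponent_lt hb (by linarith)
    simpa [hr_def] using this
  have h1r : 0 < 1 - r := by linarith
  -- per shell: `Σ_{i∈S} ½X² ≤ 2 M'² r^k`
  have hshell : ∀ k : ℕ, ∑ i ∈ S, (1 / 2 : ℝ) * X i (k : ℤ) t ^ 2 ≤ 2 * M' ^ 2 * r ^ k := by
    intro k
    have hrk : r ^ k = (1 + ε₀) ^ (-(2 * θ * (k : ℝ))) := by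
      rw [hr_def, ← Real.rpow_mul_natCast hb0]; congr 1; ring
    have hsq : ((1 + ε₀) ^ (-(θ * (k : ℝ)))) ^ 2 = (1 + ε₀) ^ (-(2 * θ * (k : ℝ))) := by
      rw [← Real.rpow_natCast, ← Real.rpow_mul hb0]; congr 1; push_cast; ring
    have hterm : ∀ i ∈ S, (1 / 2 : ℝ) * X i (k : ℤ) t ^ 2 ≤ (1 / 2 : ℝ) * M' ^ 2 * r ^ k := by
      intro i hi
      have hab := h i hi k
      have hnn : 0 ≤ M' * (1 + ε₀) ^ (-(θ * (k : ℝ))) := by positivity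
      have hx2 : X i (k : ℤ) t ^ 2 ≤ (M' * (1 + ε₀) ^ (-(θ * (k : ℝ)))) ^ 2 := by
        have := abs_le.1 hab
        exact sq_le_sq' this.1 this.2
      rw [mul_pow, hsq, ← hrk] at hx2
      nlinarith
    calc ∑ i ∈ S, (1 / 2 : ℝ) * X i (k : ℤ) t ^ 2 ≤ ∑ _i ∈ S, (1 / 2 : ℝ) * M' ^ 2 * r ^ k :=
          Finset.sum_le_sum hterm
      _ = S.card * ((1 / 2 : ℝ) * M' ^ 2 * r ^ k) := by rw [Finset.sum_const, nsmul_eq_mul]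
      _ ≤ 4 * ((1 / 2 : ℝ) * M' ^ 2 * r ^ k) := by
          have hc : (S.card : ℝ) ≤ 4 := by
            have : S.card ≤ 4 := by
              calc S.card ≤ (Finset.univ : Finset (Fin 4)).card := Finset.card_le_card (Finset.subset_univ S)
                _ = 4 := by simp
            exact_mod_cast this
          have : 0 ≤ (1 / 2 : ℝ) * M' ^ 2 * r ^ k := by positivity
          nlinarith
      _ = 2 * M' ^ 2 * r ^ k := by ring
  have hgeom : ∑ k ∈ Finset.Icc n N, r ^ k ≤ r ^ n / (1 - r) := by
    rw [← Finset.Ico_add_one_right_eq_Icc]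
    exact geom_sum_Ico_le_of_lt_one hr0.le hr1
  have hrn : r ^ n = (1 + ε₀) ^ (-(2 * θ * (n : ℝ))) := by
    rw [hr_def, ← Real.rpow_mul_natCast hb0]; congr 1; ring
  calc ∑ k ∈ Finset.Icc n N, ∑ i ∈ S, (1 / 2 : ℝ) * X i (k : ℤ) t ^ 2
      ≤ ∑ k ∈ Finset.Icc n N, 2 * M' ^ 2 * r ^ k := Finset.sum_le_sum fun k _ => hshell k
    _ = 2 * M' ^ 2 * ∑ k ∈ Finset.Icc n N, r ^ k := by rw [Finset.mul_sum]
    _ ≤ 2 * M' ^ 2 * (r ^ n / (1 - r)) := mul_le_mul_of_nonneg_left hgeom (by positivity)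
    _ = 2 * M' ^ 2 / (1 - r) * (1 + ε₀) ^ (-(2 * θ * (n : ℝ))) := by rw [← hrn]; field_simp

/-- **THE CONDITIONAL ASSEMBLY (class level).** For a table `α`, a set `P` of components with the
structural clauses (F), (Q), (T) for every forward source outside `P`, `R ≥ 1`, `0 < ε₀ ≤ 1`,
`1/2 < θ ≤ 1`, any `D`: IF the `P`-modes obey the ν-uniform `θ`-shell barrier
`(1+ε₀)^{2θk}·½X_{i,k}(t)² ≤ D·E₀` along every honest `ν`-viscous solution from one-shell data (the
S-prim hypothesis), THEN the per-table body of the crux `ForwardTailCeilingKP` holds for `(R, ε₀, α)`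
— VERBATIM the skeleton's `FwdCeilingKPAt R ε₀ α` — with `S = S⁺(α)` (the forward sources), the
same `θ`, and `C = 1600 R² max(D,1) / (1 − (1+ε₀)^{-2θ})`. MODEL lattice statement; a conditional
reduction, not a proof of the crux. [this file] -/
theorem fwdCeilingKP_of_primaryEnvelope {R ε₀ θ D : ℝ} {α : Fin 4 → Fin 4 → Fin 4 → ℤ × ℤ × ℤ → ℝ}
    (P : Finset (Fin 4)) (hR : 1 ≤ R) (hε : 0 < ε₀) (hε1 : ε₀ ≤ 1) (hθ : 1 / 2 < θ) (hθ1 : θ ≤ 1)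
    (hstruct : ∀ a, a ∉ P → (∃ e, α a a e (0, 0, 1) ≠ 0) →
      (∀ j, α j j a (0, 0, 1) ≠ 0 → j ∈ P) ∧
      (∀ i₁ i₂, i₁ ≠ a → i₂ ≠ a → α i₁ i₂ a (0, 0, 0) ≠ 0 → i₁ ∈ P ∧ i₂ ∈ P) ∧
      (∃ e, α a a e (0, 0, 1) ≠ 0 ∧ (∀ j, α e e j (0, 0, 1) ≠ 0 → j ∈ P) ∧
        (∀ j, j ≠ e → α e e j (0, 0, 0) ≠ 0 → j ∈ P)))
    (hprim : ∀ ν : ℝ, 0 < ν → ∀ (X₀ : Fin 4 → ℝ) (s : ℝ), 0 < s → ∀ X : Fin 4 → ℤ → ℝ → ℝ,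
      (∀ (i : Fin 4) (k : ℤ), X i k 0 = if k = 0 then X₀ i else 0) →
      (∀ (i : Fin 4) (k : ℤ), k < 0 → ∀ t : ℝ, X i k t = 0) →
      (∃ M : ℝ, ∀ (t : ℝ) (i : Fin 4) (k : ℤ), (1 + (1 + ε₀) ^ ((10 : ℝ) * k)) * |X i k t| ≤ M) →
      (∀ (i : Fin 4) (k : ℤ), Continuous (X i k)) →
      (∀ (i : Fin 4) (k : ℤ), ∀ t ∈ Set.Icc (0 : ℝ) s, HasDerivWithinAt (X i k)
        (quadTerm ε₀ α X i k t - ν * (1 + ε₀) ^ ((2 : ℝ) * k) * X i k t) (Set.Icc (0 : ℝ) s) t) →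
      (∀ t ∈ Set.Icc (0 : ℝ) s, ∀ (i : Fin 4) (k : ℤ), 1 ≤ k → 0 ≤ X i k t) →
      ∀ t ∈ Set.Icc (0 : ℝ) s, ∀ i ∈ P, ∀ k : ℕ,
        (1 + ε₀) ^ (2 * θ * (k : ℝ)) * ((1 / 2 : ℝ) * X i (k : ℤ) t ^ 2) ≤
          D * (∑ j : Fin 4, (1 / 2 : ℝ) * X₀ j ^ 2)) :
    InTableClass R α →
    (∀ (Y : Fin 4 → ℤ → ℝ → ℝ) (τ : ℝ), (∀ (j : Fin 4) (k : ℤ), 1 ≤ k → 0 ≤ Y j k τ) →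
      ∀ δ : ℝ, 0 < δ → ∀ (i : Fin 4) (n : ℤ), 1 ≤ n → Y i n τ = 0 → 0 ≤ quadTerm δ α Y i n τ) →
    (∀ a b i : Fin 4, a ≠ b → α a b i (0, 0, 1) = 0) →
    ∃ S : Finset (Fin 4), (∀ i, i ∉ S → ∀ j l : Fin 4, α i j l (0, 0, 1) = 0) ∧
      ∃ θ' : ℝ, 1 / 2 < θ' ∧ ∃ C : ℝ, 0 ≤ C ∧ ∀ ν : ℝ, 0 < ν → ∀ (X₀ : Fin 4 → ℝ) (s : ℝ), 0 < s →
      ∀ X : Fin 4 → ℤ → ℝ → ℝ,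
      (∀ (i : Fin 4) (k : ℤ), X i k 0 = if k = 0 then X₀ i else 0) →
      (∀ (i : Fin 4) (k : ℤ), k < 0 → ∀ t : ℝ, X i k t = 0) →
      (∃ M : ℝ, ∀ (t : ℝ) (i : Fin 4) (k : ℤ), (1 + (1 + ε₀) ^ ((10 : ℝ) * k)) * |X i k t| ≤ M) →
      (∀ (i : Fin 4) (k : ℤ), Continuous (X i k)) →
      (∀ (i : Fin 4) (k : ℤ), ∀ t ∈ Set.Icc (0 : ℝ) s, HasDerivWithinAt (X i k)
        (quadTerm ε₀ α X i k t - ν * (1 + ε₀) ^ ((2 : ℝ) * k) * X i k t) (Set.Icc (0 : ℝ) s) t) →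
      (∀ t ∈ Set.Icc (0 : ℝ) s, ∀ (i : Fin 4) (k : ℤ), 1 ≤ k → 0 ≤ X i k t) →
      ∀ n N : ℕ, n ≤ N → ∀ t ∈ Set.Icc (0 : ℝ) s,
        ∑ k ∈ Finset.Icc n N, ∑ i ∈ S, (1 / 2 : ℝ) * X i (k : ℤ) t ^ 2 ≤
          C * (∑ i : Fin 4, (1 / 2 : ℝ) * X₀ i ^ 2) * (1 + ε₀) ^ (-(2 * θ' * (n : ℝ))) := by
  classical
  intro hα hO hDg
  obtain ⟨_, hc, _⟩ := hα
  have hb : (0 : ℝ) < 1 + ε₀ := by linarith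
  have hb1lt : (1 : ℝ) < 1 + ε₀ := by linarith
  -- the forward sources
  set S : Finset (Fin 4) := Finset.univ.filter (fun a => ∃ e, α a a e (0, 0, 1) ≠ 0) with hSdef
  have hSmem : ∀ a, a ∈ S ↔ ∃ e, α a a e (0, 0, 1) ≠ 0 := by
    intro a; simp [hSdef]
  -- the constant
  set r : ℝ := (1 + ε₀) ^ (-(2 * θ)) with hr_def
  have hr1 : r < 1 := by
    have : (1 + ε₀) ^ (-(2 * θ)) < (1 + ε₀) ^ (0 : ℝ) :=
      Real.rpow_lt_rpow_of_exponent_lt hb1lt (by linarith)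
    simpa [hr_def] using this
  have h1r : 0 < 1 - r := by linarith
  refine ⟨S, ?_, θ, hθ, 1600 * R ^ 2 * max D 1 / (1 - r), by positivity, ?_⟩
  · -- non-sources have no forward feed (diagonal entries by definition of `S`, off-diagonal by (hD))
    intro i hi j l
    by_cases hij : i = j
    · subst hij
      by_contra hne
      exact hi ((hSmem i).2 ⟨l, hne⟩)
    · exact hDg i j l hij
  intro ν hν X₀ s hs X hdat hlow hMX hcont hder hnn n N hnN t ht
  set E₀ : ℝ := ∑ j : Fin 4, (1 / 2 : ℝ) * X₀ j ^ 2 with hE₀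
  have hE₀0 : 0 ≤ E₀ := Finset.sum_nonneg fun j _ => by positivity
  obtain ⟨Mw, hMw⟩ := hMX
  -- the crude bound `W = Mw` on every mode
  have hWbd : ∀ u ∈ Icc (0 : ℝ) s, ∀ (j : Fin 4) (k : ℤ), |X j k u| ≤ Mw := by
    intro u _ j k
    have h1 := hMw u j k
    have h2 : (1 : ℝ) ≤ 1 + (1 + ε₀) ^ ((10 : ℝ) * k) := by
      have := Real.rpow_pos_of_pos hb ((10 : ℝ) * k); linarith
    have h3 : |X j k u| ≤ (1 + (1 + ε₀) ^ ((10 : ℝ) * k)) * |X j k u| :=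
      le_mul_of_one_le_left (abs_nonneg _) h2
    exact h3.trans h1
  -- the energy bound at shell 0: `½X_{j,0}(u)² ≤ E₀`
  have hshell0 : ∀ u ∈ Icc (0 : ℝ) s, ∀ j, (1 / 2 : ℝ) * X j 0 u ^ 2 ≤ E₀ := by
    intro u hu j
    have hEn := orthantBreak_energy_le hε hν hc hdat hlow hMw hder hu
    have hsum : Summable fun m : ℕ => ∑ i : Fin 4, (1 / 2 : ℝ) * X i (m : ℤ) u ^ 2 :=
      (orthantBreak_summable hε hMw 0 u).congr fun m => by simp
    have h0le : (∑ i : Fin 4, (1 / 2 : ℝ) * X i ((0 : ℕ) : ℤ) u ^ 2) ≤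
        ∑' m : ℕ, ∑ i : Fin 4, (1 / 2 : ℝ) * X i (m : ℤ) u ^ 2 :=
      hsum.le_tsum 0 (fun m _ => Finset.sum_nonneg fun i _ => by positivity)
    have hj : (1 / 2 : ℝ) * X j 0 u ^ 2 ≤ ∑ i : Fin 4, (1 / 2 : ℝ) * X i ((0 : ℕ) : ℤ) u ^ 2 := by
      have := Finset.single_le_sum (f := fun i => (1 / 2 : ℝ) * X i ((0 : ℕ) : ℤ) u ^ 2)
        (fun i _ => by positivity) (Finset.mem_univ j)
      simpa using this
    simpa [hE₀] using hj.trans (h0le.trans hEn)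
  -- envelope scale `M₀ = √(2 max(D,1) E₀)`, perturbed by `δ > 0` to be positive
  set M₀ : ℝ := Real.sqrt (2 * max D 1 * E₀) with hM₀
  have hM₀0 : 0 ≤ M₀ := Real.sqrt_nonneg _
  have hD1 : D ≤ max D 1 := le_max_left _ _
  have h1D : (1 : ℝ) ≤ max D 1 := le_max_right _ _
  have hM₀sq : M₀ ^ 2 = 2 * max D 1 * E₀ := by
    rw [hM₀, Real.sq_sqrt (by positivity)]
  -- the primary envelope in amplitude form
  have hPamp : ∀ u ∈ Icc (0 : ℝ) s, ∀ i ∈ P, ∀ k : ℕ,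
      |X i (k : ℤ) u| ≤ M₀ * (1 + ε₀) ^ (-(θ * (k : ℝ))) := by
    intro u hu i hi k
    have h := hprim ν hν X₀ s hs X hdat hlow ⟨Mw, hMw⟩ hcont hder hnn u hu i hi k
    have hw : 0 < (1 + ε₀) ^ (2 * θ * (k : ℝ)) := Real.rpow_pos_of_pos hb _
    have hc' : 0 < (1 + ε₀) ^ (-(θ * (k : ℝ))) := Real.rpow_pos_of_pos hb _
    have hinv : (1 + ε₀) ^ (2 * θ * (k : ℝ)) * ((1 + ε₀) ^ (-(θ * (k : ℝ)))) ^ 2 = 1 := by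
      rw [← Real.rpow_natCast, ← Real.rpow_mul hb.le, ← Real.rpow_add hb]
      have : 2 * θ * (k : ℝ) + -(θ * (k : ℝ)) * ((2 : ℕ) : ℝ) = 0 := by push_cast; ring
      rw [this, Real.rpow_zero]
    -- `X² ≤ 2 max(D,1) E₀ (1+ε₀)^{-2θk} = (M₀ c)²`
    have hx2 : X i (k : ℤ) u ^ 2 ≤ (M₀ * (1 + ε₀) ^ (-(θ * (k : ℝ)))) ^ 2 := by
      rw [mul_pow, hM₀sq]
      have hDE : D * E₀ ≤ max D 1 * E₀ := mul_le_mul_of_nonneg_right hD1 hE₀0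
      -- multiply the barrier by `c² = (1+ε₀)^{-2θk}`
      have hmul := mul_le_mul_of_nonneg_right (h.trans hDE) (sq_nonneg ((1 + ε₀) ^ (-(θ * (k : ℝ)))))
      have hlhs : (1 + ε₀) ^ (2 * θ * (k : ℝ)) * ((1 / 2 : ℝ) * X i (k : ℤ) u ^ 2) *
          ((1 + ε₀) ^ (-(θ * (k : ℝ)))) ^ 2 = (1 / 2 : ℝ) * X i (k : ℤ) u ^ 2 := by
        have := hinv
        calc (1 + ε₀) ^ (2 * θ * (k : ℝ)) * ((1 / 2 : ℝ) * X i (k : ℤ) u ^ 2) *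
              ((1 + ε₀) ^ (-(θ * (k : ℝ)))) ^ 2
            = ((1 + ε₀) ^ (2 * θ * (k : ℝ)) * ((1 + ε₀) ^ (-(θ * (k : ℝ)))) ^ 2) *
                ((1 / 2 : ℝ) * X i (k : ℤ) u ^ 2) := by ring
          _ = (1 / 2 : ℝ) * X i (k : ℤ) u ^ 2 := by rw [this, one_mul]
      rw [hlhs] at hmul
      nlinarith [hmul]
    have hnn' : 0 ≤ M₀ * (1 + ε₀) ^ (-(θ * (k : ℝ))) := by positivity
    exact abs_le_of_sq_le_sq' hx2 hnn' |>.2 |> fun hle => abs_le.2 ⟨(abs_le_of_sq_le_sq' hx2 hnn').1, hle⟩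
  have h0amp : ∀ u ∈ Icc (0 : ℝ) s, ∀ j, |X j 0 u| ≤ M₀ := by
    intro u hu j
    have h := hshell0 u hu j
    have hx2 : X j 0 u ^ 2 ≤ M₀ ^ 2 := by
      rw [hM₀sq]; nlinarith [hE₀0, h1D, mul_nonneg (sub_nonneg.2 h1D) hE₀0]
    exact abs_le.2 ⟨(abs_le_of_sq_le_sq' hx2 hM₀0).1, (abs_le_of_sq_le_sq' hx2 hM₀0).2⟩
  -- zero datum on shells ≥ 1
  have hdat1 : ∀ (i : Fin 4) (k : ℤ), 1 ≤ k → X i k 0 = 0 := by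
    intro i k hk
    rw [hdat i k, if_neg (by omega)]
  -- every source is enveloped by `20 R (M₀ + δ)` for every `δ > 0`, hence by `20 R M₀`
  have hsources : ∀ a ∈ S, ∀ k : ℕ, |X a (k : ℤ) t| ≤ 20 * R * M₀ * (1 + ε₀) ^ (-(θ * (k : ℝ))) := by
    intro a ha k
    have hsrc := (hSmem a).1 ha
    have hc' : 0 < (1 + ε₀) ^ (-(θ * (k : ℝ))) := Real.rpow_pos_of_pos hb _
    apply le_of_forall_pos_le_add
    intro η hη
    set δ : ℝ := η / (20 * R * (1 + ε₀) ^ (-(θ * (k : ℝ)))) with hδ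
    have hδpos : 0 < δ := by positivity
    have hMδ : 0 < M₀ + δ := by linarith
    have hres := kpProper_sources_envelope_of_primary (W := Mw) ⟨‹IsSymmetricCoeff α›, hc, ‹_›⟩ hO hDg hR hε hε1 hν.le
      (by linarith) hθ1 hMδ hder hdat1 hnn hWbd P
      (fun u hu i hi m => (hPamp u hu i hi m).trans
        (mul_le_mul_of_nonneg_right (by linarith) (Real.rpow_pos_of_pos hb _).le))
      (fun u hu j => (h0amp u hu j).trans (by linarith)) hstruct t ht a hsrc k
    have : 20 * R * (M₀ + δ) * (1 + ε₀) ^ (-(θ * (k : ℝ))) =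
        20 * R * M₀ * (1 + ε₀) ^ (-(θ * (k : ℝ))) + η := by
      simp only [hδ]; field_simp
    linarith
  -- the geometric tail sum
  have htail := sources_tail_le (S := S) hε (by linarith) (by positivity) hsources n N hnN
  have hconst : 2 * (20 * R * M₀) ^ 2 / (1 - (1 + ε₀) ^ (-(2 * θ))) =
      1600 * R ^ 2 * max D 1 / (1 - r) * E₀ := by
    rw [← hr_def, mul_pow, hM₀sq]; field_simp; ring
  rw [hconst] at htail
  simpa [hE₀] using htail

end Summit.NavierStokesRegularity.NavierStokesRegularity.Theorems

end
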